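import Mathlib
import HarnessLib
import Literature.AlgebraicGeometry.Resolution.QuadraticTransforms
import Summits.ResolutionOfSingularities.ResolutionOfSingularities.Theorems.WildQuotientsWildQuotientResolutionAbelianEigenline
import Summits.ResolutionOfSingularities.ResolutionOfSingularities.Theorems.WildQuotientsWildQuotientResolutionEigenlineQuadraticTransform

/-!
# Kollár–Szabó going down, blow-up step (K2-glue): the equivariant quadratic transform of a regular local
# domain with a residue-trivial abelian action, as a ring over it
# (crux `WildQuotients.WildQuotientResolution`, stub `stub_phaseZeroHighDim`)

Crux stmt-ResolutionOfSingularities-15640 (`WildQuotientResolution`), registered stub `stub_phaseZeroHighDim`;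
programme PHASE0-KS-EIGENLINE, target `hstep` of ✓`KSGoingDown.kollarSzaboGoingDown_of_step`. The local-chart
lemma ✓`KSGoingDown.exists_fixedPoint_liftAction_of_localChart` (hand 8-g2) produces the `H`-fixed point of the
point blow-up from a LOCAL RING `R` over `𝒪_{X,x}` with `𝔪_x R = (t)` carrying residue-trivial ring
endomorphisms extending the stalk action. This file manufactures that ring from pure algebra, gluing hand 8-g0's
eigenline (✓`AbelianEigenline.exists_stable_tangentHyperplane`, ✓`exists_unit_mul_sub_mem_of_not_mem`) and hand
8-g1's `Subring K` construction (✓`EigenlineChart.exists_rsop_adapted_to_hyperplane`,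
✓`EigenlineChart.exists_equivariant_quadraticTransform`) over the fraction field `K = Frac A`:

* `exists_equivariant_quadraticTransform_of_action` — **for a regular local DOMAIN `A`, not a field, with
  algebraically closed residue field, and a residue-trivial action `τ` of an abelian group `I` by ring
  automorphisms, there is a local subring `R ⊆ Frac A` — a quadratic transform of (the image of) `A` — with an
  injective LOCAL ring map `ι : A → R`, an element `t ≠ 0` with `𝔪_A · R = (t)`, and RESIDUE-TRIVIAL ring
  endomorphisms `α_g` of `R` with `α_g ∘ ι = ι ∘ τ_g`; moreover every element of `R` is congruent to an element
  of `ι(A)` modulo `𝔪_R`** (same residue field).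

The action is transported to the model `S = image of A in K` (a regular local ring isomorphic to `A`), extended
to `K` by `IsFractionRing.ringEquivOfRingEquiv`, and restricted to the stable quadratic transform.

[OURS · crux stmt-ResolutionOfSingularities-15640 · helper toward `stub_phaseZeroHighDim` (algebraic glue for the
fixed point in the abstract blow-up step of Kollár–Szabó going down; NOT a proof of the stub); folklore, counted
0; AI-level work, weaker than expert review.] [folklore]
-/

-- single-problem summit: the doubled namespace component `ResolutionOfSingularities` is forced
set_option linter.dupNamespace false

noncomputable section

open IsLocalRing
open Literature.AlgebraicGeometry.Resolution
open Summit.ResolutionOfSingularities.ResolutionOfSingularities.Theorems.WildQuotientResolution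

namespace Summit.ResolutionOfSingularities.ResolutionOfSingularities.Theorems.WildQuotientResolution.KSGoingDown

universe u

/-! ## Transport of a residue-trivial action along a ring isomorphism -/

section Transport

variable {A B : Type u} [CommRing A] [CommRing B] [IsLocalRing A] [IsLocalRing B] (e : A ≃+* B)

/-- A ring isomorphism of local rings maps the maximal ideal into the maximal ideal (elementwise). [folklore] -/
theorem map_mem_maximalIdeal_of_ringEquiv {a : A} (ha : a ∈ maximalIdeal A) : e a ∈ maximalIdeal B := by
  rw [← map_ringEquiv_maximalIdeal e]
  exact Ideal.mem_map_of_mem _ ha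

omit [IsLocalRing A] [IsLocalRing B] in
/-- Transport of an action by ring automorphisms along a ring isomorphism `e : A ≃ B`: on `B` the element `g`
acts by `b ↦ e (τ_g (e⁻¹ b))`. [folklore] -/
theorem exists_transport_action {I : Type*} [Group I] (τ : I →* (A ≃+* A)) :
    ∃ τ' : I →* (B ≃+* B), ∀ (g : I) (b : B), τ' g b = e (τ g (e.symm b)) := by
  refine ⟨{ toFun := fun g => (e.symm.trans (τ g)).trans e
            map_one' := ?_
            map_mul' := fun g h => ?_ }, fun g b => rfl⟩
  · ext b
    simp
  · ext b
    change e (τ (g * h) (e.symm b)) = e (τ g (e.symm (e (τ h (e.symm b)))))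
    rw [map_mul, RingAut.mul_apply, e.symm_apply_apply]

/-- Residue-triviality is transported. [folklore] -/
theorem transport_residueTrivial {I : Type*} [Group I] (τ : I →* (A ≃+* A))
    (hres : ∀ (g : I) (a : A), τ g a - a ∈ maximalIdeal A) (τ' : I →* (B ≃+* B))
    (hτ' : ∀ (g : I) (b : B), τ' g b = e (τ g (e.symm b))) (g : I) (b : B) :
    τ' g b - b ∈ maximalIdeal B := by
  have h := map_mem_maximalIdeal_of_ringEquiv e (hres g (e.symm b))
  rwa [map_sub, e.apply_symm_apply, ← hτ'] at h

end Transport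

/-! ## The equivariant quadratic transform as a ring over `A` -/

/-- **The equivariant quadratic transform of a regular local domain with a residue-trivial abelian action.**
Let `A` be a regular local domain which is not a field, with algebraically closed residue field, and let an
abelian group `I` act on `A` by ring automorphisms `τ_g` with `τ_g a − a ∈ 𝔪_A`. Then there are: a local subring
`R` of `K = Frac A` which is a quadratic transform of the image `S` of `A` (✓`IsQuadraticTransform`), an
injective local ring map `ι : A → R` (the inclusion), an element `t ∈ R`, `t ≠ 0`, with `𝔪_A · R = (t)`, and
ring endomorphisms `α_g` of `R` with `α_g ∘ ι = ι ∘ τ_g` and `α_g r − r ∈ 𝔪_R`; and every `r ∈ R` is congruent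
modulo `𝔪_R` to some `ι a`. This is the Kollár–Szabó eigenline `[W]` of the blow-up of `Spec A` at its closed
point, as a local ring with its induced action (hands 8-g0/8-g1: ✓`AbelianEigenline`, ✓`EigenlineChart`).
[cite: ReichsteinYoussin2000, Appendix, proof of Prop. A.2] -/
theorem exists_equivariant_quadraticTransform_of_action {A : Type u} [CommRing A] [IsDomain A]
    [IsRegularLocalRing A] [IsAlgClosed (ResidueField A)] (hA : ¬ IsField A)
    {I : Type*} [CommGroup I] (τ : I →* (A ≃+* A)) (hres : ∀ (g : I) (a : A), τ g a - a ∈ maximalIdeal A) :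
    ∃ (R : Subring (FractionRing A)) (_ : IsLocalRing R) (ι : A →+* R) (_ : IsLocalHom ι) (t : R)
      (α : I → (R →+* R)),
      IsQuadraticTransform (algebraMap A (FractionRing A)).range R ∧
      (∀ a : A, ((ι a : R) : FractionRing A) = algebraMap A (FractionRing A) a) ∧
      Function.Injective ι ∧ t ≠ 0 ∧ (maximalIdeal A).map ι = Ideal.span {t} ∧
      (∀ g : I, (α g).comp ι = ι.comp (τ g : A →+* A)) ∧
      (∀ (g : I) (r : R), α g r - r ∈ maximalIdeal R) ∧
      (∀ r : R, ∃ a : A, ι a - r ∈ maximalIdeal R) := by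
  classical
  -- the model `S = image of A` in `K = Frac A`
  let K := FractionRing A
  let f : A →+* K := algebraMap A K
  have hf : Function.Injective f := IsFractionRing.injective A K
  let S : Subring K := f.range
  have hrr : Function.Injective f.rangeRestrict := fun a b h => hf (congrArg Subtype.val h)
  let e : A ≃+* S := RingEquiv.ofBijective f.rangeRestrict ⟨hrr, RingHom.rangeRestrict_surjective f⟩
  have he : ∀ a : A, ((e a : S) : K) = f a := fun a => rfl
  haveI : IsRegularLocalRing S := IsRegularLocalRing.of_ringEquiv e
  haveI : IsAlgClosed (ResidueField S) :=
    IsAlgClosed.of_ringEquiv (ResidueField A) (ResidueField S) (ResidueField.mapEquiv e)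
  have hS : ¬ IsField S := fun h => hA (MulEquiv.isField h e.toMulEquiv)
  -- the transported action on `S` and the extended action on `K`
  obtain ⟨τS, hτS⟩ := exists_transport_action e τ
  have hresS : ∀ (g : I) (s : S), τS g s - s ∈ maximalIdeal S := transport_residueTrivial e τ hres τS hτS
  let σK : I → (K ≃+* K) := fun g => IsFractionRing.ringEquivOfRingEquiv (τ g)
  have hσK : ∀ (g : I) (a : A), σK g (f a) = f (τ g a) := fun g a =>
    IsFractionRing.ringEquivOfRingEquiv_algebraMap (τ g) a
  have hσS : ∀ g : I, ∀ s ∈ S, σK g s ∈ S := by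
    rintro g _ ⟨a, rfl⟩
    exact ⟨τ g a, (hσK g a).symm⟩
  have heS : ∀ (s : S), ∃ a : A, s = e a := fun s => ⟨e.symm s, (e.apply_symm_apply s).symm⟩
  have hσS' : ∀ (g : I) (s : S), (⟨σK g s, hσS g s s.2⟩ : S) = τS g s := by
    intro g s
    obtain ⟨a, rfl⟩ := heS s
    apply Subtype.ext
    change σK g (f a) = ((τS g (e a) : S) : K)
    rw [hσK, hτS, e.symm_apply_apply, he]
  -- the stable tangent hyperplane `W` and an adapted regular system of parameters `x`, `x i = t`
  obtain ⟨W, hW2, hWle, hWne, hsup, hstab⟩ :=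
    AbelianEigenline.exists_stable_tangentHyperplane τS hresS hS
  obtain ⟨t, htm, htW⟩ : ∃ t ∈ maximalIdeal S, t ∉ W := SetLike.exists_of_lt (lt_of_le_of_ne hWle hWne)
  obtain ⟨x, i, hx, hxit, hxW, hWle'⟩ :=
    EigenlineChart.exists_rsop_adapted_to_hyperplane (A := S) rfl W hW2 htm htW (hsup t htm htW)
  have hxi : x i ≠ 0 := by
    rw [hxit]
    rintro rfl
    exact htW W.zero_mem
  have hres' : ∀ (g : I) (s : S), (⟨σK g s, hσS g s s.2⟩ : S) - s ∈ maximalIdeal S := fun g s => by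
    rw [hσS']
    exact hresS g s
  have hWσ : ∀ (g : I) (j), j ≠ i → (⟨σK g ((x j : S) : K), hσS g _ (x j).2⟩ : S) ∈ W := fun g j hj => by
    rw [hσS']
    exact hstab g _ (hxW j hj)
  have ht' : ∀ g : I, ∃ u : S, IsUnit u ∧ (⟨σK g ((x i : S) : K), hσS g _ (x i).2⟩ : S) - u * x i ∈ W :=
    fun g => by
    rw [hσS', hxit]
    exact AbelianEigenline.exists_unit_mul_sub_mem_of_not_mem τS hresS W hW2 hstab htm htW (hsup t htm htW) g
  -- hand 8-g1: the stable quadratic transform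
  obtain ⟨R₁, hQT, -, hfrac, hstabR, hresR, hcongR⟩ :=
    EigenlineChart.exists_equivariant_quadraticTransform S rfl x hx i hxi hWle' σK hσS hres' hWσ ht'
  haveI : IsLocalRing R₁ := hQT.isLocalRing
  have hSR : S ≤ R₁ := hQT.dominates.1
  -- the structure map `ι : A → R₁`
  let ι : A →+* R₁ := (Subring.inclusion hSR).comp (e : A →+* S)
  have hι : ∀ a : A, ((ι a : R₁) : K) = f a := fun a => rfl
  have hιinj : Function.Injective ι := fun a b h => hf (by rw [← hι, ← hι, h])
  haveI hloc : IsLocalHom ι := by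
    refine ⟨fun a ha => ?_⟩
    obtain ⟨h0, hinv⟩ := (isUnit_subring_iff_inv_mem (ι a)).mp ha
    rw [hι] at h0 hinv
    have hinvS : (f a)⁻¹ ∈ S := hQT.dominates.2 (f a) ⟨a, rfl⟩ hinv
    have hu : IsUnit (e a) := (isUnit_subring_iff_inv_mem (e a)).mpr ⟨h0, hinvS⟩
    simpa using hu.map e.symm
  -- the element `t = x i` read in `R₁` and `𝔪_A R₁ = (t)`
  let tR : R₁ := ⟨((x i : S) : K), hSR (x i).2⟩
  have htR0 : tR ≠ 0 := by
    intro h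
    have h' : ((x i : S) : K) = 0 := congrArg Subtype.val h
    exact hxi (Subtype.ext h')
  have hmapS : (maximalIdeal A).map (e : A →+* S) = maximalIdeal S := map_ringEquiv_maximalIdeal e
  have hmap : (maximalIdeal A).map ι = Ideal.span {tR} := by
    change (maximalIdeal A).map ((Subring.inclusion hSR).comp (e : A →+* S)) = _
    rw [← Ideal.map_map, hmapS, ← hx, Ideal.map_span]
    apply le_antisymm
    · refine Ideal.span_le.mpr ?_
      rintro _ ⟨_, ⟨j, rfl⟩, rfl⟩
      by_cases hj : j = i
      · subst hj
        exact Ideal.subset_span rfl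
      · obtain ⟨hq, -⟩ := hfrac j hj
        refine Ideal.mem_span_singleton'.mpr ⟨⟨_, hq⟩, Subtype.ext ?_⟩
        change ((x j : S) : K) / ((x i : S) : K) * ((x i : S) : K) = ((x j : S) : K)
        exact div_mul_cancel₀ _ fun h => hxi (Subtype.ext h)
    · refine Ideal.span_le.mpr ?_
      rintro _ rfl
      exact Ideal.subset_span ⟨x i, ⟨i, rfl⟩, rfl⟩
  -- the restricted endomorphisms
  let α : I → (R₁ →+* R₁) := fun g => (σK g : K →+* K).restrict R₁ R₁ (hstabR g)
  have hα : ∀ (g : I) (r : R₁), ((α g r : R₁) : K) = σK g r := fun g r => rfl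
  refine ⟨R₁, inferInstance, ι, hloc, tR, α, hQT, hι, hιinj, htR0, hmap, fun g => ?_, fun g r => ?_,
    fun r => ?_⟩
  · ext a
    change σK g (f a) = f (τ g a)
    exact hσK g a
  · rw [mem_maximalIdeal_iff_inv_not_mem]
    have e1 : ((α g r - r : R₁) : K) = σK g r - r := by rw [AddSubgroupClass.coe_sub, hα]
    rw [e1]
    exact hresR g r r.2
  · obtain ⟨s, hs, hrs⟩ := hcongR r r.2
    obtain ⟨a, ha⟩ := heS ⟨s, hs⟩
    have ha : ((e a : S) : K) = s := (congrArg Subtype.val ha).symm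
    refine ⟨a, ?_⟩
    have e2 : ι a - r = -(r - ι a) := by ring
    rw [e2]
    refine neg_mem_iff.mpr ?_
    rw [mem_maximalIdeal_iff_inv_not_mem]
    have e3 : ((r - ι a : R₁) : K) = (r : K) - s := by
      rw [AddSubgroupClass.coe_sub, hι, ← he, ← ha]
    rw [e3]
    exact hrs

end Summit.ResolutionOfSingularities.ResolutionOfSingularities.Theorems.WildQuotientResolution.KSGoingDown

end
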